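import Summits.BirchSwinnertonDyer.Rank1Residual.X12.RamifiedSelmerCardRoute
import Literature.NumberTheory.EllipticCurves.HeegnerPointsKolyvaginDescentProofs
import Mathlib.GroupTheory.Perm.Cycle.Type
import HarnessLib

/-!
# O11 at `p = 7`, ROUTE U — `hSW` from (U-D): `#Sel^{(p)}(E/K) ∣ p` and rank `1` force `Ш(E/K)[p] = 0`

HONEST FRAMING (cell `bsd-cm`, run/shared/lean/pub/bsd-cm/, verbatim): the programme isolates, for
CM elliptic curves over `ℚ` of analytic rank `≤ 1`, classes on which the FULL BSD formula is
reduced — strictly by PUBLISHED theorems entering as named-fact binders — to ONE local problem at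
ONE prime, and then TYPES that residual problem. Seat `bsd-cm-ram` (generation 3), TARGET.md §2
T-U5. THEOREMS ONLY; nothing asserted about any curve; no label moves.

T-U5 (`RouteU.bsdp_of_thm120_of_rem310`, the typed THEOREM U) carries the binder
`hSW : 7 ∤ #Ш(E/ℚ)`; the unit-case file `RouteUSevenUnitCase.lean` carries instead the descent input
(U-D) `RouteU.SelmerSevenBound W := #Sel⁷(E/ℚ) ∣ 7` (memo ROUTE-U Prop. D(a), from `7 ∤ β₁(D)`).
This file proves (U-D) ∧ rank `1` ⇒ `hSW`, for any number field and any prime, by composing the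
tree's `X12.card_selmerGroup_eq_of_dvd_of_rank_eq_one` (`#Sel^{(p)} = p`), Mordell–Weil
(`pow_finrank_dvd_natCard_quotient_range_zsmul`: a point outside `pE(K)` exists in rank `1`), the
fundamental exact sequence (`Typed.noPTorsion_of_card_selmerGroup_eq_prime`: `Ш[p] = 0`) and
Cauchy's theorem. So the two Route-U kernel routes take the SAME descent input.
References: [SilvermanAEC2009] Thm. X.4.2 (a), VIII (Mordell–Weil).
-/

noncomputable section

open scoped Classical
open WeierstrassCurve Literature.NumberTheory.EllipticCurves
  Literature.NumberTheory.EllipticCurves.Rank1Residual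

namespace Summit.BirchSwinnertonDyer.Rank1Residual.X12.O11.RouteU

/-! ## `hSW` from the descent input (U-D): `#Sel⁷(E/ℚ) ∣ 7` and rank `1` ⇒ `7 ∤ #Ш(E/ℚ)` -/

/-- **`#Sel^{(p)}(E/ℚ) ∣ p` and `rank E(ℚ) = 1` ⇒ `Ш(E/ℚ)[p] = 0`** (so `p ∤ #Ш` when `Ш` is finite):
`#Sel^{(p)} = p` (`X12.card_selmerGroup_eq_of_dvd_of_rank_eq_one`), a rational point outside
`pE(ℚ)` exists since `p ∣ #(E(ℚ)/pE(ℚ))` (Mordell–Weil, `pow_finrank_dvd_natCard_quotient_range_zsmul`),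
and the fundamental exact sequence kills `Ш[p]` (`Typed.noPTorsion_of_card_selmerGroup_eq_prime`).
This turns T-U5's binder `hSW` into the (U-D) input `RouteU.SelmerSevenBound W` of the unit-case
file (at `p = 7`, rank `1` by GZK). [cite: SilvermanAEC2009, Thm X.4.2(a)] -/
theorem sha_noPTorsion_of_card_selmerGroup_dvd {K : Type*} [Field K] [NumberField K]
    (W : WeierstrassCurve K) [W.IsElliptic] (p : ℕ) [hp : Fact p.Prime] (hrank : W.mordellWeilRank = 1)
    (hdvd : Nat.card (W.selmerGroup (p : ℤ)) ∣ p) :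
    ∀ x : W.sha, (p : ℤ) • x = 0 → x = 0 := by
  have hcard := X12.card_selmerGroup_eq_of_dvd_of_rank_eq_one W p hdvd hrank
  refine Typed.noPTorsion_of_card_selmerGroup_eq_prime W p hcard ?_
  -- a point outside `pE(K)`: `p ∣ [E(K) : pE(K)]`
  haveI : Module.Finite ℤ W.toAffine.Point := W.module_finite_point_holds
  haveI : NeZero p := ⟨hp.out.ne_zero⟩
  by_contra hall
  push Not at hall
  have h := pow_finrank_dvd_natCard_quotient_range_zsmul (A := W.toAffine.Point) p
  have hrank' : Module.finrank ℤ W.toAffine.Point = 1 := hrank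
  have htop : (zsmulAddGroupHom (α := W.toAffine.Point) (p : ℤ)).range = ⊤ :=
    top_le_iff.mp fun P _ => hall P
  rw [hrank', pow_one, htop, ← AddSubgroup.index_eq_card, AddSubgroup.index_top] at h
  exact hp.out.one_lt.ne' (Nat.dvd_one.mp h)

/-- **`hSW` of T-U5 from (U-D)**: for `W/K` of Mordell–Weil rank `1` with `#Sel^{(p)}(E/K) ∣ p`
and `Ш(E/K)` finite, `p ∤ #Ш(E/K)` (Cauchy). At `K = ℚ`, `p = 7` on 𝒞₇ / for `49a1^{(D)}`: `hdvd`
= `RouteU.SelmerSevenBound W`, rank `1` by GZK. [cite: SilvermanAEC2009, Thm X.4.2(a)] -/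
theorem not_dvd_shaOrder_of_card_selmerGroup_dvd {K : Type*} [Field K] [NumberField K]
    (W : WeierstrassCurve K) [W.IsElliptic] (p : ℕ) [hp : Fact p.Prime]
    (hrank : W.mordellWeilRank = 1) (hdvd : Nat.card (W.selmerGroup (p : ℤ)) ∣ p) [Finite W.sha] :
    ¬ p ∣ W.shaOrder := by
  intro h
  obtain ⟨x, hx⟩ := exists_prime_addOrderOf_dvd_card' (G := W.sha) p h
  have hx0 : x ≠ 0 := by
    intro h0
    rw [h0, addOrderOf_zero] at hx
    exact hp.out.one_lt.ne' hx.symm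
  have hpx : (p : ℤ) • x = 0 := by
    rw [natCast_zsmul, ← hx]
    exact addOrderOf_nsmul_eq_zero x
  exact hx0 (sha_noPTorsion_of_card_selmerGroup_dvd W p hrank hdvd x hpx)

/-- The analytic-rank form used by T-U5 / the sequel: `ord_{s=1} L(E,s) = 1`, GZK (`hGZK`) and
`#Sel^{(p)}(E/ℚ) ∣ p` give `p ∤ #Ш(E/ℚ)`. [cite: SilvermanAEC2009, Thm X.4.2(a)] -/
theorem not_dvd_shaOrder_of_analyticRank_eq_one (hGZK : rank_eq_analyticRank_of_analyticRank_le_one)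
    (W : WeierstrassCurve ℚ) [W.IsElliptic] (p : ℕ) [Fact p.Prime] (hr : W.analyticRank = 1)
    (hdvd : Nat.card (W.selmerGroup (p : ℤ)) ∣ p) [Finite W.sha] : ¬ p ∣ W.shaOrder :=
  not_dvd_shaOrder_of_card_selmerGroup_dvd W p (by rw [(hGZK W (by rw [hr])).1, hr]) hdvd

end Summit.BirchSwinnertonDyer.Rank1Residual.X12.O11.RouteU

end
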